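import Summits.KontsevichZagierPeriods.KontsevichZagierPeriods.Theses.HurwitzMicroSectors
import Literature.NumberTheory.Transcendental.BoxIntegralHurwitzWeightTwo

/-!
# Route HurwitzMicroSectors — `RigidityTwoSix` (item stmt-KontsevichZagierPeriods-3874)

The rigidity half of the level-`6`, weight-`2` box sector: under Calegari–Dimitrov–Tang's
Theorem 1 (`1, π², L(2,χ₋₃)` are `ℚ`-linearly independent, carried as the item's own explicit
hypothesis, which is `Literature.NumberTheory.Transcendental.calegariDimitrovTang_linearIndependent`
verbatim), two normal-form integral representations `a + b/(1−xy) + c/(1+xy+x²y²)` and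
`a' + b'/(1−xy) + c'/(1+xy+x²y²)` (`a, …, c' ∈ ℚ`) on the open unit box `(0,1)²` with equal values
have `(a,b,c) = (a',b',c')`.

Proof: the value of a normal-form representation is `a + b·π²/6 + c·L(2,χ₋₃)`
(`BoxIntegral.setIntegral_box_normalForm`: the box has volume `1`,
`∫∫ dxdy/(1−xy) = π²/6`, `∫∫ dxdy/(1+xy+x²y²) = L(2,χ₋₃)`), and then
`BoxIntegral.normalForm_coeff_eq` compares coefficients using the linear independence.

References: [CalegariDimitrovTang2024, Thm. 1 (p. 3)], [KontsevichZagier2001, §1.1].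
-/

namespace Summit.KontsevichZagierPeriods.Theorems.HurwitzMicroSectorsRigidityTwoSix

open MeasureTheory Set Literature.NumberTheory.Transcendental

/-- The value of a normal-form integral representation on the open unit box `(0,1)²` with
integrand `a + b/(1−x₀x₁) + c/(1+x₀x₁+(x₀x₁)²)` there is `a + b·π²/6 + c·L(2,χ₋₃)`. -/
theorem value_of_normalForm (a b c : ℚ) (r : KZ.IntegralRep 2)
    (hd : r.domain = {x | ∀ i, x i ∈ Set.Ioo (0:ℝ) 1})
    (hi : Set.EqOn r.integrand
      (fun x => (a : ℝ) + b / (1 - x 0 * x 1) + c / (1 + x 0 * x 1 + (x 0 * x 1) ^ 2)) r.domain) :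
    r.value = a + b * (Real.pi ^ 2 / 6) + c * L2chi3 := by
  unfold KZ.IntegralRep.value
  rw [← BoxIntegral.setIntegral_box_normalForm (a : ℝ) b c, hd]
  refine setIntegral_congr_fun (Beukers.measurableSet_cube 2) ?_
  rw [← hd]
  exact hi

/-- **`RigidityTwoSix`** (route HurwitzMicroSectors, item stmt-KontsevichZagierPeriods-3874):
under CDT's Theorem 1, two rational normal forms `a + b/(1−xy) + c/(1+xy+x²y²)` and
`a' + b'/(1−xy) + c'/(1+xy+x²y²)` on the open box `(0,1)²` with equal values have equal
coefficients. -/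
theorem rigidityTwoSix_proof :
    Summit.KontsevichZagierPeriods.KontsevichZagierPeriods.Theses.HurwitzMicroSectors.RigidityTwoSix := by
  unfold Summit.KontsevichZagierPeriods.KontsevichZagierPeriods.Theses.HurwitzMicroSectors.RigidityTwoSix
  intro h a b c a' b' c' r r' hd hi hd' hi' hv
  have e1 := value_of_normalForm a b c r hd hi
  have e2 := value_of_normalForm a' b' c' r' hd' hi'
  exact BoxIntegral.normalForm_coeff_eq h (by rw [← e1, ← e2, hv])

end Summit.KontsevichZagierPeriods.Theorems.HurwitzMicroSectorsRigidityTwoSix
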